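import Summits.AtomisticToContinuum.HydrodynamicLimit.Theses.OneFlightGossipEngine
import Summits.AtomisticToContinuum.HydrodynamicLimit.Theorems.ImplosionDichotomyHydroLimitInBandWindowContinuityEstimate
import Literature.MathematicalPhysics.KineticTheory.HardSphereEulerProofs
import HarnessLib

/-!
# Window continuity of the relative-entropy ledger, in band (stub `stub_windowContinuityInBand` of line
`IdeatorOneSketch`, crux `HydroLimitInBand`, stmt-AtomisticToContinuum-9133; skeleton v8)

Support file (`--supports stmt-AtomisticToContinuum-9133`). Registered stub (skeleton
`Cruxes/HydroLimitInBand/Lines/IdeatorOneSketch.lean`, v8):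
`stub_windowContinuityInBand : OneFlightGossipEngine.CollisionActivityTails → CollisionEnergyActivityTails →
OneFlightGossipEngine.EnergyCurrentTails → WindowContinuityInBand`; the two line-local propositions
`CollisionEnergyActivityTails`, `WindowContinuityInBand` are restated here byte-identically (same short names, this
file's namespace), exactly as the sibling crux 14680's helper `…ClampedCurrentsDockLedgerGlue.lean` does.

Proof summary. The three inputs are used at ONE fixed level each (`ε = 1`, CAT/CEAT at their own `V₀` with the
common window `τ' = max τ₀ τ`, ECT with its `M`); `σ₀ = min (CAT, CEAT, ECT thresholds, 1/2)`. For fixed `N` and a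
window `[s, s'] ⊆ [0, t]` the one-window estimate `abs_klDiv_window_sub_le`
(`…WindowContinuityEstimate`: explicit entropies `EntropyClockDock.toReal_klDiv_lawAt_eq_integral`, the sibling
dock's pathwise balance `ClampedCurrentsDockPathwise.gSum_sub_eq` for the unit-activity exponent with the cubic
streaming bound of `…WindowContinuityFields` priced in mean by `…WindowContinuityStreaming` (Tonelli, energy
conservation, ECT), the pair-kernel collision sum priced by the window activities of `…WindowContinuityTransfer`
(CAT, CEAT), the activity part by the joint Lipschitz bound of `log(ρ Rf(σ³ρ))` and the mean displacement bound,
the log-partition increment by monotonicity in the activity) gives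
`|H_N(s') − H_N(s)| ≤ (s' − s)(N+1)A₁ + 4Lε_N(N+1)[τ₁'(V₁+1) + τ₂'(V₂+1)]/σ… = (N+1)ν_N · const`,
`ν_N = (N+1)^{-1/3} → 0`, whence the claim for `N ≥ N₀`.
-/

noncomputable section

open MeasureTheory Filter Set Topology InformationTheory
open scoped ENNReal

namespace Summit.AtomisticToContinuum.HydrodynamicLimit.Theorems.HydroLimitInBandContinuity

open Literature.MathematicalPhysics.KineticTheory Literature.Analysis.FluidPDE
open Literature.Analysis.FunctionSpaces
open Summit.AtomisticToContinuum.HydrodynamicLimit.Theses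
open Summit.AtomisticToContinuum.HydrodynamicLimit.Theorems
  (lintegral_meanVelObs_localGibbsMeasure_le lintegral_norm_sq_gaussMeasure)

/-- **The ENERGY-activity twin of `CollisionActivityTails`** (prices the energy part of the transfer clamp) — byte-identical with
the sibling's `CoherenceNotTails.CollisionEnergyActivityTails`. A registered input SIGNATURE of the line (route-internal
proposition in the vocabulary of the crux), not a cited fact. -/
def CollisionEnergyActivityTails : Prop :=
  ∀ (a₀ θ₀ : T3 → ℝ) (u₀ : T3 → V3), Continuous a₀ → Continuous θ₀ → Continuous u₀ → (∀ x, 0 < a₀ x) →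
    (∀ x, 0 < θ₀ x) → ∃ σ₀ : ℝ, 0 < σ₀ ∧ ∀ σ : ℝ, 0 < σ → σ < σ₀ →
    ∀ (T : ℝ) (ρ θ : ℝ → T3 → ℝ) (u : ℝ → T3 → V3), IsHardSphereEulerSolution σ T ρ u θ →
    ∀ Φ : (N : ℕ) → HardSphereFlow (Torus.geometry (Fin 3)) (hsDiameter σ N) (N + 1),
    TendstoHydroFieldsAt (fun N => localGibbsLaw σ a₀ u₀ θ₀ N (Φ N)) Φ ρ u θ 0 →
    ∀ t ∈ Set.Ico 0 T, ∃ V₀ : ℝ, 0 < V₀ ∧ ∀ V : ℝ, V₀ ≤ V → ∀ ε : ℝ, 0 < ε → ∃ τ₀ : ℝ, 0 < τ₀ ∧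
    ∀ τ : ℝ, τ₀ ≤ τ → ∃ N₀ : ℕ, ∀ N : ℕ, N₀ ≤ N → ∀ s ∈ Set.Icc 0 t,
      (let w : ℝ := τ * ((N : ℝ) + 1) ^ (-(1 / 3 : ℝ))
       let P := localGibbsLaw σ a₀ u₀ θ₀ N (Φ N)
       let act := fun (i : Fin (N + 1)) (z : Config (N + 1) (Fin 3) T3) =>
         σ / τ * (Φ N).collisionSum (Set.Ioc s (s + w))
           (fun c => if c.fst = i then |‖c.postVel.1‖ ^ 2 - ‖c.preVel.1‖ ^ 2| / 2 else 0) z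
       ∫⁻ z, ENNReal.ofReal (((N : ℝ) + 1)⁻¹ * ∑ i : Fin (N + 1),
           Set.indicator {y : ℝ | V < y} (fun y => y) (act i z)) ∂P ≤ ENNReal.ofReal ε)

/-- **v8 joint 1 = `WindowContinuityInBand`** — CRUDE SHORT-TIME CONTINUITY OF THE RELATIVE ENTROPY along the explicit
reference family, in band. For an insertion factor `Rf ∈ [1,2]`, Lipschitz on `[0,r]`, continuous positive profiles, there is
`σ₀` such that for `0 < σ < σ₀`, every classical solution, every tied flow family, `t ∈ (0,T)` with packing `ρ_s σ³ < r` on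
`[0,t]`, every window scale `τ > 0` and `ε > 0`: for `N ≥ N₀` and all `s ≤ s′` in `[0,t]` with `s′ − s ≤ τ (N+1)^{-1/3}`,
`|H_N(s′) − H_N(s)| ≤ (N+1) ε`. Intended proof (worker brief): the landed one-window balance identity R1 with the smooth
references `ψ_s`, `ψ_{s′}`; the streaming integral is `O((s′−s)(N+1))` in `L¹(f_s)` by conservation of `Σ|v_i|²`, bounded
third moments (ECT at one fixed level) and uniform bounds on the reference gradients; the transfer terms are bounded by the
window collisional activities (monotone in the window; CAT / CEAT at one fixed clamp level, contact ⇒ `|φ(x_i) − φ(x_j)| ≤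
‖∇φ‖_∞ σ (N+1)^{-1/3}`), hence `O(τ (N+1)^{2/3})`; the reference switch `E_{f_{s′}}[Σ (g_{ψ_s} − g_{ψ_{s′}})] + log Z′/Z` is
`O((s′−s)(N+1))` by the time-Lipschitz bounds of `(log(ρ Rf(σ³ρ)), u, θ)` on `[0,t] × 𝕋³`. A registered stub
SIGNATURE of the line (route-internal proposition in the vocabulary of the crux; Yau 1991 §2 for the method), not a
cited fact. -/
def WindowContinuityInBand : Prop :=
  ∀ (r : ℝ) (Rf : ℝ → ℝ), 0 < r → (∀ x ∈ Icc 0 r, 1 ≤ Rf x ∧ Rf x ≤ 2) →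
    (∃ L : NNReal, LipschitzOnWith L Rf (Icc 0 r)) →
    ∀ (a₀ θ₀ : T3 → ℝ) (u₀ : T3 → V3), Continuous a₀ → Continuous θ₀ → Continuous u₀ →
      (∀ x, 0 < a₀ x) → (∀ x, 0 < θ₀ x) →
      ∃ σ₀ : ℝ, 0 < σ₀ ∧ ∀ σ : ℝ, 0 < σ → σ < σ₀ →
        ∀ (T : ℝ) (ρ θ : ℝ → T3 → ℝ) (u : ℝ → T3 → V3), IsHardSphereEulerSolution σ T ρ u θ →
          ∀ Φ : (N : ℕ) → HardSphereFlow (Torus.geometry (Fin 3)) (hsDiameter σ N) (N + 1),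
            TendstoHydroFieldsAt (fun N => localGibbsLaw σ a₀ u₀ θ₀ N (Φ N)) Φ ρ u θ 0 →
            ∀ t ∈ Set.Ioo 0 T, (∀ s ∈ Set.Icc 0 t, ∀ x, ρ s x * σ ^ 3 < r) →
              ∀ τ : ℝ, 0 < τ → ∀ ε : ℝ, 0 < ε → ∃ N₀ : ℕ, ∀ N : ℕ, N₀ ≤ N →
                ∀ s ∈ Set.Icc 0 t, ∀ s' ∈ Set.Icc 0 t, s ≤ s' → s' ≤ s + τ * ((N : ℝ) + 1) ^ (-(1 / 3 : ℝ)) →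
                  |(klDiv ((Φ N).lawAt (localGibbsLaw σ a₀ u₀ θ₀ N (Φ N)) s')
                      (localGibbsLaw σ (fun x => ρ s' x * Rf (σ ^ 3 * ρ s' x)) (u s') (θ s') N (Φ N))).toReal -
                    (klDiv ((Φ N).lawAt (localGibbsLaw σ a₀ u₀ θ₀ N (Φ N)) s)
                      (localGibbsLaw σ (fun x => ρ s x * Rf (σ ^ 3 * ρ s x)) (u s) (θ s) N (Φ N))).toReal| ≤
                  ((N : ℝ) + 1) * ε

/-- **Stub `stub_windowContinuityInBand` of line `IdeatorOneSketch` (crux stmt-9133, skeleton v8).** CAT (momentum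
activity), CEAT (energy activity) and ECT (cubic tails), each at ONE fixed level, give the crude short-time continuity of
`H_N` along the explicit reference family, in band. [cite: Yau1991, §2] -/
theorem stub_windowContinuityInBand :
    OneFlightGossipEngine.CollisionActivityTails → CollisionEnergyActivityTails →
      OneFlightGossipEngine.EnergyCurrentTails → WindowContinuityInBand := by
  intro hCAT hCEAT hECT r Rf hr hRf hRfL a₀ θ₀ u₀ ha hθ hu ha0 hθ0
  obtain ⟨σ₁, hσ₁, h1⟩ := hCAT a₀ θ₀ u₀ ha hθ hu ha0 hθ0
  obtain ⟨σ₂, hσ₂, h2⟩ := hCEAT a₀ θ₀ u₀ ha hθ hu ha0 hθ0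
  obtain ⟨σ₃, hσ₃, h3⟩ := hECT a₀ θ₀ u₀ ha hθ hu ha0 hθ0
  refine ⟨min (min σ₁ σ₂) (min σ₃ (1 / 2)), lt_min (lt_min hσ₁ hσ₂) (lt_min hσ₃ one_half_pos),
    fun σ hσ hσlt T ρ θ u hE Φ hlim t ht hpack τ hτ ε hε => ?_⟩
  have hσ1 : σ < σ₁ := hσlt.trans_le ((min_le_left _ _).trans (min_le_left _ _))
  have hσ2' : σ < σ₂ := hσlt.trans_le ((min_le_left _ _).trans (min_le_right _ _))
  have hσ3 : σ < σ₃ := hσlt.trans_le ((min_le_right _ _).trans (min_le_left _ _))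
  have hσhalf : σ < 1 / 2 := hσlt.trans_le ((min_le_right _ _).trans (min_le_right _ _))
  have ht0T : t ∈ Ico 0 T := ⟨ht.1.le, ht.2⟩
  have htT : Icc 0 t ⊆ Ico 0 T := Icc_subset_Ico_right ht.2
  -- the three inputs, each at ONE fixed level
  obtain ⟨V₁, hV₁, hCAT1⟩ := h1 σ hσ hσ1 T ρ θ u hE Φ hlim t ht0T
  obtain ⟨τ₁, hτ₁, hCAT2⟩ := hCAT1 V₁ le_rfl 1 one_pos
  obtain ⟨N₁, hN₁⟩ := hCAT2 (max τ₁ τ) (le_max_left _ _)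
  obtain ⟨V₂, hV₂, hCEAT1⟩ := h2 σ hσ hσ2' T ρ θ u hE Φ hlim t ht0T
  obtain ⟨τ₂, hτ₂, hCEAT2⟩ := hCEAT1 V₂ le_rfl 1 one_pos
  obtain ⟨N₂, hN₂⟩ := hCEAT2 (max τ₂ τ) (le_max_left _ _)
  obtain ⟨M, N₃, hN₃⟩ := h3 σ hσ hσ3 T ρ θ u hE Φ hlim t ht0T 1 one_pos
  have hτ₁' : 0 < max τ₁ τ := lt_max_of_lt_left hτ₁
  have hτ₂' : 0 < max τ₂ τ := lt_max_of_lt_left hτ₂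
  -- slab constants of the Euler solution
  obtain ⟨K, hK0, hK⟩ :=
    exists_abs_DgExp_one_le hE.smooth_temperature hE.smooth_velocity hE.temperature_pos ht.2
  choose Lb hLb0 hLb using fun j : Fin 3 => exists_lipschitz_slab
    (isSmoothSpaceTimeOn_momPart hE.smooth_temperature hE.smooth_velocity hE.temperature_pos j) ht.1 ht.2
  obtain ⟨Lγ, hLγ0, hLγ⟩ := exists_lipschitz_slab
    (isSmoothSpaceTimeOn_inv hE.smooth_temperature hE.temperature_pos) ht.1 ht.2
  have hSL0 : 0 ≤ ∑ j, Lb j := Finset.sum_nonneg fun j _ => hLb0 j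
  set L : ℝ := ∑ j, Lb j + Lγ with hLdef
  have hL0 : 0 ≤ L := by positivity
  have hd0 : ∀ x x' : T3, 0 ≤ Torus.euclidDist x x' := fun x x' => by
    rw [Torus.euclidDist_eq]; exact norm_nonneg _
  have hβ : ∀ r' ∈ Icc 0 t, ∀ (x x' : T3) (j : Fin 3),
      |u r' x j / θ r' x - u r' x' j / θ r' x'| ≤ L * Torus.euclidDist x x' := by
    intro r' hr' x x' j
    have h := hLb j r' hr' r' hr' x x'
    rw [sub_self, abs_zero, zero_add, Real.norm_eq_abs] at h
    refine h.trans (mul_le_mul_of_nonneg_right ?_ (hd0 x x'))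
    have := Finset.single_le_sum (fun j _ => hLb0 j) (Finset.mem_univ j)
    rw [hLdef]
    linarith
  have hγ : ∀ r' ∈ Icc 0 t, ∀ x x' : T3, |(θ r' x)⁻¹ - (θ r' x')⁻¹| ≤ L * Torus.euclidDist x x' := by
    intro r' hr' x x'
    have h := hLγ r' hr' r' hr' x x'
    rw [sub_self, abs_zero, zero_add, Real.norm_eq_abs] at h
    refine h.trans (mul_le_mul_of_nonneg_right ?_ (hd0 x x'))
    rw [hLdef]
    linarith
  obtain ⟨Kρ, hKρ0, hKρ⟩ := exists_lipschitz_slab hE.smooth_density ht.1 ht.2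
  -- a positive lower bound on the density over the slab
  obtain ⟨Ki, hKi⟩ := (isSmoothSpaceTimeOn_inv hE.smooth_density hE.density_pos).exists_norm_le_of_isCompact
    isCompact_Icc htT
  have hm : ∀ s₁ ∈ Icc 0 t, ∀ x, (|Ki| + 1)⁻¹ ≤ ρ s₁ x := by
    intro s₁ hs₁ x
    have hρ := hE.density_pos s₁ (htT hs₁) x
    have h := hKi s₁ hs₁ x
    rw [Real.norm_eq_abs] at h
    rw [inv_le_comm₀ (by positivity) hρ]
    linarith [le_abs_self (ρ s₁ x)⁻¹, le_abs_self Ki]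
  -- the Lipschitz constant of the insertion factor
  obtain ⟨LR, hLR⟩ := hRfL
  -- the second moment of the velocities at time zero
  obtain ⟨U, -, hU⟩ := exists_forall_abs_le_of_continuous (χ := fun x => ‖u₀ x‖) hu.norm
  obtain ⟨Θ, -, hΘ⟩ := exists_forall_abs_le_of_continuous hθ
  have hΘ0 : 0 ≤ Θ := (abs_nonneg _).trans (hΘ 0)
  have hCKE0 : 0 ≤ U ^ 2 + 3 * Θ := by positivity
  have hKE : ∀ N, ∫⁻ z, ENNReal.ofReal (((N : ℝ) + 1)⁻¹ * ∑ i, ‖(z i).2‖ ^ 2)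
      ∂(localGibbsLaw σ a₀ u₀ θ₀ N (Φ N)) ≤ ENNReal.ofReal (U ^ 2 + 3 * Θ) := by
    intro N
    rw [localGibbsLaw_eq]
    refine lintegral_meanVelObs_localGibbsMeasure_le ha hθ hu (fun x => (ha0 x).le) hθ0
      (f := fun v : V3 => ‖v‖ ^ 2) (by fun_prop) (fun v => sq_nonneg _) (fun y => ?_) σ N
    rw [lintegral_norm_sq_gaussMeasure (u₀ y) (hθ0 y)]
    have h1 : ‖u₀ y‖ ≤ U := by simpa only [abs_of_nonneg (norm_nonneg _)] using hU y
    exact ENNReal.ofReal_le_ofReal (by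
      nlinarith [(le_abs_self _).trans (hΘ y), pow_le_pow_left₀ (norm_nonneg _) h1 2])
  -- the total constant and the threshold in `N`
  set A₁ : ℝ := K * (2 + max M 0 * (U ^ 2 + 3 * Θ)) +
    (((|Ki| + 1)⁻¹)⁻¹ + LR * σ ^ 3) * Kρ * (3 + (U ^ 2 + 3 * Θ)) / 2 +
    (((|Ki| + 1)⁻¹)⁻¹ + LR * σ ^ 3) * Kρ with hA₁
  have hA₁0 : 0 ≤ A₁ := by positivity
  set Ktot : ℝ := τ * A₁ + 4 * L * (max τ₁ τ * (V₁ + 1) + max τ₂ τ * (V₂ + 1)) + 1 with hKtot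
  have hKtot0 : 0 < Ktot := by positivity
  have hν : Tendsto (fun N : ℕ => ((N : ℝ) + 1) ^ (-(1 / 3 : ℝ))) atTop (𝓝 0) :=
    (tendsto_rpow_neg_atTop (by norm_num : (0 : ℝ) < 1 / 3)).comp
      (tendsto_atTop_add_const_right _ 1 tendsto_natCast_atTop_atTop)
  obtain ⟨N₄, hN₄⟩ := eventually_atTop.1 (hν.eventually_lt_const (div_pos hε hKtot0))
  refine ⟨max (max N₁ N₂) (max N₃ N₄), fun N hN s hs s' hs' hss' hs'le => ?_⟩
  have hN1 : N₁ ≤ N := ((le_max_left _ _).trans (le_max_left _ _)).trans hN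
  have hN2 : N₂ ≤ N := ((le_max_right _ _).trans (le_max_left _ _)).trans hN
  have hN3 : N₃ ≤ N := ((le_max_left _ _).trans (le_max_right _ _)).trans hN
  have hN4 : N₄ ≤ N := ((le_max_right _ _).trans (le_max_right _ _)).trans hN
  set ν : ℝ := ((N : ℝ) + 1) ^ (-(1 / 3 : ℝ)) with hνdef
  have hν0 : 0 < ν := Real.rpow_pos_of_pos (by positivity) _
  have hνle : ν ≤ ε / Ktot := (hN₄ N hN4).le
  have hεN : hsDiameter σ N = σ * ν := by
    rw [hνdef, hsDiameter]
    push_cast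
    ring
  -- the one-window estimate at this `N`
  have hmain := abs_klDiv_window_sub_le hσ hσhalf ha hθ hu ha0 hθ0 hE ht hRf hLR hpack N (Φ N) hK0 hK hL0 hβ hγ
    hKρ0 hKρ (m := (|Ki| + 1)⁻¹) (by positivity) hm hCKE0 (hKE N) (M := M)
    (fun r' hr' => hN₃ N hN3 r' hr') hV₁.le (κ₁ := σ / max τ₁ τ) (w₁ := max τ₁ τ * ν) (div_pos hσ hτ₁')
    (fun s₁ hs₁ => by
      have h := hN₁ N hN1 s₁ hs₁
      dsimp only at h
      exact h)
    hV₂.le (κ₂ := σ / max τ₂ τ) (w₂ := max τ₂ τ * ν) (div_pos hσ hτ₂')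
    (fun s₁ hs₁ => by
      have h := hN₂ N hN2 s₁ hs₁
      dsimp only at h
      exact h)
    hs hs' hss'
    (hs'le.trans (add_le_add le_rfl (mul_le_mul_of_nonneg_right (le_max_right τ₁ τ) hν0.le)))
    (hs'le.trans (add_le_add le_rfl (mul_le_mul_of_nonneg_right (le_max_right τ₂ τ) hν0.le)))
  refine hmain.trans ?_
  -- bookkeeping: everything is `(N+1) ν_N · const`
  have hN0 : (0 : ℝ) < (N : ℝ) + 1 := by positivity
  have hss : s' - s ≤ τ * ν := by linarith [hs'le]
  have step1 : (s' - s) * (((N : ℝ) + 1) * A₁) ≤ τ * ν * (((N : ℝ) + 1) * A₁) :=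
    mul_le_mul_of_nonneg_right hss (by positivity)
  have step2 : 4 * L * hsDiameter σ N *
      (((N : ℝ) + 1) * ((σ / max τ₁ τ)⁻¹ * (V₁ + 1) + (σ / max τ₂ τ)⁻¹ * (V₂ + 1))) =
      ν * ((N : ℝ) + 1) * (4 * L * (max τ₁ τ * (V₁ + 1) + max τ₂ τ * (V₂ + 1))) := by
    rw [hεN, inv_div, inv_div]
    field_simp
  have hνK : ν * Ktot ≤ ε := by rwa [← le_div_iff₀ hKtot0]
  calc (s' - s) * (((N : ℝ) + 1) * A₁) + 4 * L * hsDiameter σ N *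
        (((N : ℝ) + 1) * ((σ / max τ₁ τ)⁻¹ * (V₁ + 1) + (σ / max τ₂ τ)⁻¹ * (V₂ + 1)))
      ≤ τ * ν * (((N : ℝ) + 1) * A₁) +
          ν * ((N : ℝ) + 1) * (4 * L * (max τ₁ τ * (V₁ + 1) + max τ₂ τ * (V₂ + 1))) := by
        rw [step2]
        linarith [step1]
    _ = ((N : ℝ) + 1) * (ν * (Ktot - 1)) := by
        rw [hKtot]
        ring
    _ ≤ ((N : ℝ) + 1) * (ν * Ktot) := by
        refine mul_le_mul_of_nonneg_left (mul_le_mul_of_nonneg_left (by linarith) hν0.le) hN0.le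
    _ ≤ ((N : ℝ) + 1) * ε := mul_le_mul_of_nonneg_left hνK hN0.le

end Summit.AtomisticToContinuum.HydrodynamicLimit.Theorems.HydroLimitInBandContinuity

end
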